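import Summits.RiemannHypothesis.RiemannHypothesis.Theorems.GroundBartaEvenWinsBeyondArchDeflationUpperY
import Summits.RiemannHypothesis.RiemannHypothesis.Theorems.GroundBartaEvenWinsBeyondArchDeflationMarkovY2
import Summits.RiemannHypothesis.RiemannHypothesis.Theorems.GroundBartaEvenWinsBeyondArchArchM78FF78e2
import HarnessLib

/-!
# The parity ladder beyond `log 2`: SHARP U-side at `b = 39/50` — `ε(39/50) ≤ 1/(6·10¹⁵)`

Support file (GroundBarta rung 4 / WeilParity item stmt-RiemannHypothesis-18085, helper), RH-free.  Prover A (gen 5).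
Rayleigh–Ritz upper bound at the window `39/50` from the A-layer certificates of the even degree-`54` Ritz vector `f78e2`
(`f78e2_T`, width `8e-28`), the exact norm and the SHARP Markov bracket `dt_weilMarkovConstant_sharp` (width `2.7e-18`):
`ε(39/50) ≤ 1.6246e-16 ≤ 1/(6·10¹⁵)` (`dt_groundEnergy_le_of_T`).  This replaces `trialUpper78` (`1/(70·10¹²)`, degree 26,
coarse Markov bracket) as the U-side of the LAST three-prime cell `[39/50, 4023/5000]`, whose L-side `λ₅` must stay below
`ε_od(4023/5000) ≈ 1.02e-14`.
-/

set_option linter.dupNamespace false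

noncomputable section

namespace Summit.RiemannHypothesis.RiemannHypothesis.Theorems.EvenWinsBeyondArch

open Literature.NumberTheory.LFunctions Literature.Analysis.ValidatedNumerics.ExpPoly
open Literature.Analysis.ValidatedNumerics.PolyMP Summit.RiemannHypothesis.RiemannHypothesis.Theorems.EvenWinsBeyondArch.ArchM78F

set_option maxHeartbeats 0 in
/-- The exact `∫_{-1}^{1} P²` of the sharp U-side trial vector at `39/50`. [folklore] -/
theorem f78e2_IQ : integPolyQ f78e2P f78e2P 1 = ((61796335658284924563937433924929725327276641242461827345441999508791265506001869802313 : ℚ)/48201141813462241159877546671346094016120888178286845994385086869412413313389061734400) := by decide +kernel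

/-- **`ε(39/50) ≤ 1/(6·10¹⁵)`** (sharp U-side at `39/50`, even degree-54 Ritz vector, sharp Markov bracket). [folklore] -/
theorem trialUpper78sharp : weilGroundEnergy (39 / 50 : ℝ) ≤ (1 / 6000000000000000 : ℝ) := by
  have hT := f78e2_T
  have h2 := m78_log2_lt
  have h5 := m78_le_log5
  push_cast at h2 h5
  have hM := dt_weilMarkovConstant_sharp h2 h5
  have h := dt_groundEnergy_le_of_T f78e2P f78e2E (b := 39 / 50) (by norm_num) f78e2_hE
    (Thi := 55659980269275271229196655656496972462830597468925332831856103708661199133305483400395819427128880419903823368800853656865685037456360039116012297045833789103015243149/6694603029647533494427437037686957502239012246984284165886817620751724071304036352000000000000000000000000000000000000000000000000000000000000000000000000000000000000)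
    (Mlo := 83141569444492860373 / 10000000000000000000)
    (by push_cast at hT ⊢; exact hT.2) (by push_cast at hM ⊢; exact hM.1) (by rw [f78e2_IQ]; norm_num)
  rw [f78e2_IQ] at h
  push_cast at h
  refine le_trans h ?_
  norm_num

end Summit.RiemannHypothesis.RiemannHypothesis.Theorems.EvenWinsBeyondArch

end
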